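import Literature.NumberTheory.NumberFields.ClassGroupCoprimeGaloisDescentCongruence
import Literature.NumberTheory.IwasawaTheory.ClassicalMuVanishesCyclicAscentOdd
import Literature.NumberTheory.IwasawaTheory.ClassicalMuVanishesQuadraticAscent
import Literature.NumberTheory.IwasawaTheory.ClassicalLambdaInvariant
import Literature.NumberTheory.EllipticCurves.ZpExtensionRestrictCyclotomic
import Literature.NumberTheory.EllipticCurves.FineSelmerClassGroupPRankBoundedProofs
import HarnessLib

/-!
# Along a `ℤ_p`-tower, a Galois extension `L/K` of `ℓ`-power degree (`ℓ ≠ p`) changes `e_n`, `rank_p Cl` and `λ` by multiples of the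
# order of `p` mod `ℓ`: `p^{e_n(L)} ≡ p^{e_n(K)}`, `p^{r_n(L)} ≡ p^{r_n(K)}`, `p^{λ(L)} ≡ p^{λ(K)} (mod ℓ)`; cubic `L/K`, `p = 2`: PARITY

Topic `NumberTheory/IwasawaTheory` (namespace = path).  THEOREM-ONLY file (no definition, no named fact, no `sorry`), written by the prover seat
`bsd-line-att-p3` g29 (cell `bsd-f1-sign2`, route `AlignedTransportAtTwo`, crux C2 stmt-BirchSwinnertonDyer-22298: the sextic carrier `ℚ(W[2])` is a
Galois cubic extension of the resolvent `ℚ(√Δ_W)`; closes nothing; BSD is proved for no curve here).  The tower form of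
`NumberFields/ClassGroupCoprimeGaloisDescentCongruence.lean` (same seat: `#Cl(B)[p^k]^{Gal(B/A)} = #Cl(A)[p^k]` + orbit counting for a Galois
`ℓ`-group extension `B/A`).

SETTING (the tree's restricted towers, Washington §13.1).  `K` a number field, `κ` a `ℤ_p`-extension of `K` (layers `K_n = κ.layer n ⊆ K̄`),
`L/K` a finite GALOIS extension whose group is an `ℓ`-group, `ℓ ≠ p` prime (so `p ∤ [L:K]` and `L ∩ K_∞ = K`: `κ ∘ res` is onto,
`surjective_comp_absGaloisRestrict_of_not_dvd_finrank`); the `n`-th layer of the restricted tower `κ|_L` is `B_n = j(L)·K_n ⊇ A_n = K_n`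
(`nonempty_ringEquiv_layer_restrict_fieldRange_sup_layer`), a Galois extension of number fields with `[B_n : A_n] = [L : K]`
(`isGalois_layer_fieldRange_sup_layer`, `finrank_layer_fieldRange_sup_layer`), hence again with an `ℓ`-group.  Layer by layer the number-field
file gives:

* §1 `classNumberPExp_le_restrict_of_isPGroup` (`e_n(κ) ≤ e_n(κ|_L)`), `classGroupPRank_le_restrict_of_isPGroup` (`r_n(κ) ≤ r_n(κ|_L)`),
  ★ **`pow_classNumberPExp_restrict_modEq`** (`p^{e_n(κ|_L)} ≡ p^{e_n(κ)} (mod ℓ)`), ★ **`pow_classGroupPRank_restrict_modEq`**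
  (`p^{r_n(κ|_L)} ≡ p^{r_n(κ)} (mod ℓ)`), for every `n`.
* §2 `λ`: `classicalMuVanishes_of_restrict_of_isPGroup` (`μ(κ|_L) = 0 ⟹ μ(κ) = 0`, hI-free), `classicalLambda_le_restrict_of_isPGroup`
  (`λ(κ) ≤ λ(κ|_L)`), ★ **`pow_classicalLambda_restrict_modEq`** (`μ(κ|_L) = 0 ⟹ p^{λ(κ|_L)} ≡ p^{λ(κ)} (mod ℓ)`: compare the congruences at
  `n` and `n+1` for `n ≫ 0` and cancel `p^{e_n}`).
* §3 parity (`p ≡ −1 (mod ℓ)`, `2 < ℓ`, e.g. `ℓ = 3`, `p = 2`): `classNumberPExp_restrict_modEq_two`, `classGroupPRank_restrict_modEq_two`,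
  `classicalLambda_restrict_modEq_two`; ★ the cubic case at `p = 2` (`[L : K] ∣ 3`): **`e_n(κ|_L) ≡ e_n(κ)`, `r_n(κ|_L) ≡ r_n(κ)`,
  `λ(κ|_L) ≡ λ(κ) (mod 2)`**.
* §4 cyclotomic consumer forms (normalisation-free): `κK`, `κL` ANY cyclotomic `ℤ_p`-extensions of `K`, `L` (`L/K` Galois, `ℓ`-group, `ℓ ≠ p`):
  the same congruences / parities between `e_n(κL)`, `r_n(κL)`, `λ(κL)` and `e_n(κK)`, `r_n(κK)`, `λ(κK)` (`κL` has the layers of `κK|_L`: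
  `isCyclotomic_restrict`, `classNumberPExp_eq_of_isCyclotomic`, `classGroupPRank_eq_of_isCyclotomic`).

This is the finite-level shadow of the `ℤ_p[Gal(L/K)]`-decomposition `X(L_∞) ∼ X(K_∞) ⊕ X'` with `X'` a module over a product of
unramified extensions of `ℤ_p` of degree `f = ord_ℓ(p)` (Washington §10.1, Thm. 10.8), obtained here with no `Λ`-modules.

References: [Washington1997] §10.1, Thm. 10.8, §13.1, §13.3 Prop. 13.22–13.23; [NeukirchANT1999] Ch. III §1 Prop. (1.6) (ii), (iv);
[Iwasawa1973MuInvariants] §3 («`λ(K/k) ≤ λ(K'/k')`»); tree files cited inline.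
-/

set_option autoImplicit false

noncomputable section

open scoped NumberField
open NumberField Field IntermediateField

namespace Literature.NumberTheory.IwasawaTheory

open Literature.NumberTheory.EllipticCurves Literature.NumberTheory.EllipticCurves.ZpExtension
  Literature.NumberTheory.GaloisRepresentations Literature.NumberTheory.NumberFields

variable {K : Type} [Field K] [NumberField K] {p : ℕ} [Fact p.Prime]

/-! ### §1 Layer by layer: `e_n`, `r_n` of `κ|_L` versus `κ` -/

section Layers

variable (κ : ZpExtension K p) (L : Type) [Field L] [NumberField L] [Algebra K L] [IsGalois K L] {ℓ : ℕ} [Fact ℓ.Prime]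

/-- `p ∤ [L : K]` when `Gal(L/K)` is an `ℓ`-group and `p ≠ ℓ`, so `κ ∘ res_{L/K}` is onto (`L ∩ K_∞ = K`). [cite: Washington1997, §13.1] -/
theorem surjective_comp_absGaloisRestrict_of_isPGroup (hG : IsPGroup ℓ (L ≃ₐ[K] L)) (hpℓ : p ≠ ℓ) :
    Function.Surjective (κ.toContinuousMonoidHom.comp (absGaloisRestrict K L)) :=
  surjective_comp_absGaloisRestrict_of_not_dvd_finrank κ L (not_dvd_finrank_of_isPGroup K L hG hpℓ)

/-- The Galois group of the layer `B_n = j(L)·K_n` over `A_n = K_n` is an `ℓ`-group when `Gal(L/K)` is (`[B_n : A_n] = [L : K] = ℓ^a`).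
[cite: Washington1997, §13.1 (`Gal(LK_n/K_n) ≅ Gal(L/K)` for `L ∩ K_∞ = K`)] -/
theorem isPGroup_gal_layer_fieldRange_sup_layer (hG : IsPGroup ℓ (L ≃ₐ[K] L))
    (h : Function.Surjective (κ.toContinuousMonoidHom.comp (absGaloisRestrict K L))) (j : L →ₐ[K] AlgebraicClosure K) (n : ℕ) :
    letI : Algebra ↥(κ.layer n) ↥(j.fieldRange ⊔ κ.layer n) :=
      (IntermediateField.inclusion (le_sup_right : κ.layer n ≤ j.fieldRange ⊔ κ.layer n)).toRingHom.toAlgebra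
    IsPGroup ℓ (↥(j.fieldRange ⊔ κ.layer n) ≃ₐ[↥(κ.layer n)] ↥(j.fieldRange ⊔ κ.layer n)) := by
  letI : Algebra ↥(κ.layer n) ↥(j.fieldRange ⊔ κ.layer n) :=
    (IntermediateField.inclusion (le_sup_right : κ.layer n ≤ j.fieldRange ⊔ κ.layer n)).toRingHom.toAlgebra
  haveI : FiniteDimensional K L := Module.Finite.of_restrictScalars_finite ℚ K L
  haveI := isGalois_layer_fieldRange_sup_layer κ L j n
  haveI : FiniteDimensional K ↥(κ.layer n) := κ.finiteDimensional_layer_holds n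
  haveI : NumberField ↥(κ.layer n) := NumberField.of_module_finite K _
  haveI : NumberField ↥(j.fieldRange ⊔ κ.layer n) := numberField_fieldRange_sup_layer κ L j n
  haveI : FiniteDimensional ↥(κ.layer n) ↥(j.fieldRange ⊔ κ.layer n) := Module.Finite.of_restrictScalars_finite ℚ _ _
  obtain ⟨a, ha⟩ := IsPGroup.iff_card.mp hG
  refine IsPGroup.of_card (n := a) ?_
  rw [IsGalois.card_aut_eq_finrank, finrank_layer_fieldRange_sup_layer κ L h j n, ← IsGalois.card_aut_eq_finrank, ha]

/-- **`e_n(κ) ≤ e_n(κ|_L)`** for `Gal(L/K)` an `ℓ`-group, `ℓ ≠ p` (the case `K = F` of the tree's `classNumberPExp_restrict_le_of_not_dvd_finrank`,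
with `κ` itself on the left). [cite: Iwasawa1973MuInvariants, §3] [cite: NeukirchANT1999, Ch. III §1 Prop. (1.6) (ii)] -/
theorem classNumberPExp_le_restrict_of_isPGroup (hG : IsPGroup ℓ (L ≃ₐ[K] L)) (hpℓ : p ≠ ℓ)
    (h : Function.Surjective (κ.toContinuousMonoidHom.comp (absGaloisRestrict K L))) (n : ℕ) :
    classNumberPExp κ n ≤ classNumberPExp (κ.restrict L h) n := by
  haveI : FiniteDimensional K L := Module.Finite.of_restrictScalars_finite ℚ K L
  set j : L →ₐ[K] AlgebraicClosure K := absEmbedding K L with hj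
  letI : Algebra ↥(κ.layer n) ↥(j.fieldRange ⊔ κ.layer n) :=
    (IntermediateField.inclusion (le_sup_right : κ.layer n ≤ j.fieldRange ⊔ κ.layer n)).toRingHom.toAlgebra
  haveI := isGalois_layer_fieldRange_sup_layer κ L j n
  haveI : FiniteDimensional K ↥(κ.layer n) := κ.finiteDimensional_layer_holds n
  haveI : NumberField ↥(κ.layer n) := NumberField.of_module_finite K _
  haveI : NumberField ↥(j.fieldRange ⊔ κ.layer n) := numberField_fieldRange_sup_layer κ L j n
  have hGn := isPGroup_gal_layer_fieldRange_sup_layer κ L hG h j n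
  have hpn := not_dvd_finrank_of_isPGroup ↥(κ.layer n) ↥(j.fieldRange ⊔ κ.layer n) hGn hpℓ
  rw [classNumberPExp_def, classNumberPExp_def, natCard_classGroup_layer_restrict_eq κ L h j n]
  exact padicValNat_card_classGroup_le_of_not_dvd_finrank ↥(κ.layer n) ↥(j.fieldRange ⊔ κ.layer n) hpn

/-- **`r_n(κ) ≤ r_n(κ|_L)`** (`p`-ranks of class groups) for `Gal(L/K)` an `ℓ`-group, `ℓ ≠ p`. [cite: Washington1997, §10.1 and §13.3]
[cite: NeukirchANT1999, Ch. III §1 Prop. (1.6) (ii)] -/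
theorem classGroupPRank_le_restrict_of_isPGroup (hG : IsPGroup ℓ (L ≃ₐ[K] L)) (hpℓ : p ≠ ℓ)
    (h : Function.Surjective (κ.toContinuousMonoidHom.comp (absGaloisRestrict K L))) (n : ℕ) :
    classGroupPRank κ n ≤ classGroupPRank (κ.restrict L h) n := by
  haveI : FiniteDimensional K L := Module.Finite.of_restrictScalars_finite ℚ K L
  set j : L →ₐ[K] AlgebraicClosure K := absEmbedding K L with hj
  letI : Algebra ↥(κ.layer n) ↥(j.fieldRange ⊔ κ.layer n) :=
    (IntermediateField.inclusion (le_sup_right : κ.layer n ≤ j.fieldRange ⊔ κ.layer n)).toRingHom.toAlgebra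
  haveI := isGalois_layer_fieldRange_sup_layer κ L j n
  haveI : FiniteDimensional K ↥(κ.layer n) := κ.finiteDimensional_layer_holds n
  haveI : NumberField ↥(κ.layer n) := NumberField.of_module_finite K _
  haveI : NumberField ↥(j.fieldRange ⊔ κ.layer n) := numberField_fieldRange_sup_layer κ L j n
  have hGn := isPGroup_gal_layer_fieldRange_sup_layer κ L hG h j n
  have hpn := not_dvd_finrank_of_isPGroup ↥(κ.layer n) ↥(j.fieldRange ⊔ κ.layer n) hGn hpℓ
  rw [classGroupPRank_def κ, classGroupPRank_restrict_eq κ L h j n]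
  exact padicValNat_card_quotient_pow_le_of_not_dvd_finrank ↥(κ.layer n) ↥(j.fieldRange ⊔ κ.layer n) hpn

/-- ★ **`p^{e_n(κ|_L)} ≡ p^{e_n(κ)} (mod ℓ)`** at every layer `n`, for `Gal(L/K)` an `ℓ`-group and `ℓ ≠ p`: the layer `j(L)·K_n / K_n` is Galois
with an `ℓ`-group, and `NumberFields.pow_padicValNat_card_classGroup_modEq` applies.  So `e_n(κ|_L) − e_n(κ)` is a non-negative multiple of
the order of `p` modulo `ℓ`. [cite: Washington1997, §10.1, Thm. 10.8 and §13.1] -/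
theorem pow_classNumberPExp_restrict_modEq (hG : IsPGroup ℓ (L ≃ₐ[K] L)) (hpℓ : p ≠ ℓ)
    (h : Function.Surjective (κ.toContinuousMonoidHom.comp (absGaloisRestrict K L))) (n : ℕ) :
    p ^ classNumberPExp (κ.restrict L h) n ≡ p ^ classNumberPExp κ n [MOD ℓ] := by
  haveI : FiniteDimensional K L := Module.Finite.of_restrictScalars_finite ℚ K L
  set j : L →ₐ[K] AlgebraicClosure K := absEmbedding K L with hj
  letI : Algebra ↥(κ.layer n) ↥(j.fieldRange ⊔ κ.layer n) :=
    (IntermediateField.inclusion (le_sup_right : κ.layer n ≤ j.fieldRange ⊔ κ.layer n)).toRingHom.toAlgebra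
  haveI := isGalois_layer_fieldRange_sup_layer κ L j n
  haveI : FiniteDimensional K ↥(κ.layer n) := κ.finiteDimensional_layer_holds n
  haveI : NumberField ↥(κ.layer n) := NumberField.of_module_finite K _
  haveI : NumberField ↥(j.fieldRange ⊔ κ.layer n) := numberField_fieldRange_sup_layer κ L j n
  have hGn := isPGroup_gal_layer_fieldRange_sup_layer κ L hG h j n
  rw [classNumberPExp_def, classNumberPExp_def, natCard_classGroup_layer_restrict_eq κ L h j n]
  exact pow_padicValNat_card_classGroup_modEq ↥(κ.layer n) ↥(j.fieldRange ⊔ κ.layer n) hGn hpℓ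

/-- ★ **`p^{r_n(κ|_L)} ≡ p^{r_n(κ)} (mod ℓ)`** (`p`-ranks of the class groups of the `n`-th layers) for `Gal(L/K)` an `ℓ`-group, `ℓ ≠ p`:
`r_n(κ|_L) − r_n(κ)` is a non-negative multiple of the order of `p` mod `ℓ`. [cite: Washington1997, Thm. 10.8 and §13.1] -/
theorem pow_classGroupPRank_restrict_modEq (hG : IsPGroup ℓ (L ≃ₐ[K] L)) (hpℓ : p ≠ ℓ)
    (h : Function.Surjective (κ.toContinuousMonoidHom.comp (absGaloisRestrict K L))) (n : ℕ) :
    p ^ classGroupPRank (κ.restrict L h) n ≡ p ^ classGroupPRank κ n [MOD ℓ] := by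
  haveI : FiniteDimensional K L := Module.Finite.of_restrictScalars_finite ℚ K L
  set j : L →ₐ[K] AlgebraicClosure K := absEmbedding K L with hj
  letI : Algebra ↥(κ.layer n) ↥(j.fieldRange ⊔ κ.layer n) :=
    (IntermediateField.inclusion (le_sup_right : κ.layer n ≤ j.fieldRange ⊔ κ.layer n)).toRingHom.toAlgebra
  haveI := isGalois_layer_fieldRange_sup_layer κ L j n
  haveI : FiniteDimensional K ↥(κ.layer n) := κ.finiteDimensional_layer_holds n
  haveI : NumberField ↥(κ.layer n) := NumberField.of_module_finite K _
  haveI : NumberField ↥(j.fieldRange ⊔ κ.layer n) := numberField_fieldRange_sup_layer κ L j n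
  have hGn := isPGroup_gal_layer_fieldRange_sup_layer κ L hG h j n
  rw [classGroupPRank_def κ, classGroupPRank_restrict_eq κ L h j n]
  exact pow_padicValNat_card_quotient_pow_modEq ↥(κ.layer n) ↥(j.fieldRange ⊔ κ.layer n) hGn hpℓ

/-! ### §2 The `λ`-invariants -/

/-- **`μ(κ|_L) = 0 ⟹ μ(κ) = 0`** (growth form, no growth theorem): `e_n(κ) ≤ e_n(κ|_L) ≤ λ' n + ν'`, and a linear upper bound forces the
growth form (tree `classicalMuVanishes_of_classNumberPExp_le_linear'`). [cite: Iwasawa1973MuInvariants, §3] [cite: Washington1997, §13.3 Prop. 13.23] -/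
theorem classicalMuVanishes_of_restrict_of_isPGroup (hG : IsPGroup ℓ (L ≃ₐ[K] L)) (hpℓ : p ≠ ℓ)
    (h : Function.Surjective (κ.toContinuousMonoidHom.comp (absGaloisRestrict K L))) (hμ : ClassicalMuVanishes (κ.restrict L h)) :
    ClassicalMuVanishes κ := by
  obtain ⟨ν, n₀, hν⟩ := classicalLambda_spec (κ.restrict L h) hμ
  refine classicalMuVanishes_of_classNumberPExp_le_linear' κ (a := classicalLambda (κ.restrict L h)) (b := ν.toNat) (n₁ := n₀)
    fun n hn => ?_
  have h1 := classNumberPExp_le_restrict_of_isPGroup κ L hG hpℓ h n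
  have h2 := hν n hn
  have h3 : (classNumberPExp (κ.restrict L h) n : ℤ) ≤ classicalLambda (κ.restrict L h) * n + ν.toNat := by
    rw [h2]; linarith [Int.self_le_toNat ν]
  have h4 : classNumberPExp (κ.restrict L h) n ≤ classicalLambda (κ.restrict L h) * n + ν.toNat := by exact_mod_cast h3
  exact h1.trans h4

/-- **`λ(κ) ≤ λ(κ|_L)`** (granted `μ(κ|_L) = 0`; Iwasawa 1973 §3 «`λ(K/k) ≤ λ(K'/k')`», here for an `ℓ`-group step, `ℓ ≠ p`): two growth laws with
`e_n(κ) ≤ e_n(κ|_L)` for all `n`. [cite: Iwasawa1973MuInvariants, §3] [cite: Washington1997, §13.3 Thm. 13.13] -/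
theorem classicalLambda_le_restrict_of_isPGroup (hG : IsPGroup ℓ (L ≃ₐ[K] L)) (hpℓ : p ≠ ℓ)
    (h : Function.Surjective (κ.toContinuousMonoidHom.comp (absGaloisRestrict K L))) (hμ : ClassicalMuVanishes (κ.restrict L h)) :
    classicalLambda κ ≤ classicalLambda (κ.restrict L h) := by
  have hμK := classicalMuVanishes_of_restrict_of_isPGroup κ L hG hpℓ h hμ
  obtain ⟨ν, n₀, hν⟩ := classicalLambda_spec κ hμK
  obtain ⟨ν', n₁, hν'⟩ := classicalLambda_spec (κ.restrict L h) hμ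
  by_contra hlt
  rw [not_le] at hlt
  -- at `n = N` large, `λ N + ν ≤ λ' N + ν'` with `λ ≥ λ' + 1` is impossible
  set N : ℕ := max (max n₀ n₁) ((ν' - ν).toNat + 1) with hN
  have hn₀ : n₀ ≤ N := (le_max_left _ _).trans (le_max_left _ _)
  have hn₁ : n₁ ≤ N := (le_max_right _ _).trans (le_max_left _ _)
  have hN1 : (ν' - ν).toNat + 1 ≤ N := le_max_right _ _
  have hle : (classNumberPExp κ N : ℤ) ≤ classNumberPExp (κ.restrict L h) N := by
    exact_mod_cast classNumberPExp_le_restrict_of_isPGroup κ L hG hpℓ h N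
  rw [hν N hn₀, hν' N hn₁] at hle
  have hlt' : ((classicalLambda (κ.restrict L h) : ℤ) + 1) ≤ classicalLambda κ := by exact_mod_cast hlt
  have hNz : ((ν' - ν).toNat : ℤ) + 1 ≤ N := by exact_mod_cast hN1
  have hνν : ν' - ν ≤ ((ν' - ν).toNat : ℤ) := Int.self_le_toNat _
  have hmul : (((classicalLambda (κ.restrict L h) : ℤ) + 1)) * N ≤ (classicalLambda κ : ℤ) * N :=
    mul_le_mul_of_nonneg_right hlt' (Nat.cast_nonneg N)
  nlinarith

/-- ★ **`p^{λ(κ|_L)} ≡ p^{λ(κ)} (mod ℓ)`** (granted `μ(κ|_L) = 0`), for `Gal(L/K)` an `ℓ`-group, `ℓ ≠ p`: for `n ≫ 0`,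
`p^{e_{n+1}} = p^{e_n} · p^{λ}` on both towers, the congruences `p^{e_m(κ|_L)} ≡ p^{e_m(κ)}` at `m = n, n+1` give
`p^{e_n(κ|_L)} p^{λ(κ|_L)} ≡ p^{e_n(κ|_L)} p^{λ(κ)}`, and `p^{e_n}` is invertible mod `ℓ`.  So `λ(κ|_L) − λ(κ)` is a non-negative multiple of the order of
`p` mod `ℓ`. [cite: Washington1997, Thm. 10.8 and §13.3 Thm. 13.13] [cite: Iwasawa1973MuInvariants, §3] -/
theorem pow_classicalLambda_restrict_modEq (hG : IsPGroup ℓ (L ≃ₐ[K] L)) (hpℓ : p ≠ ℓ)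
    (h : Function.Surjective (κ.toContinuousMonoidHom.comp (absGaloisRestrict K L))) (hμ : ClassicalMuVanishes (κ.restrict L h)) :
    p ^ classicalLambda (κ.restrict L h) ≡ p ^ classicalLambda κ [MOD ℓ] := by
  have hμK := classicalMuVanishes_of_restrict_of_isPGroup κ L hG hpℓ h hμ
  obtain ⟨n₀, h0⟩ := classNumberPExp_succ_sub_eq_classicalLambda κ hμK
  obtain ⟨n₁, h1⟩ := classNumberPExp_succ_sub_eq_classicalLambda (κ.restrict L h) hμ
  set N := max n₀ n₁ with hN
  have eK : classNumberPExp κ (N + 1) = classNumberPExp κ N + classicalLambda κ := by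
    have := h0 N (le_max_left _ _); omega
  have eL : classNumberPExp (κ.restrict L h) (N + 1) = classNumberPExp (κ.restrict L h) N + classicalLambda (κ.restrict L h) := by
    have := h1 N (le_max_right _ _); omega
  have cN := pow_classNumberPExp_restrict_modEq κ L hG hpℓ h N
  have cN1 := pow_classNumberPExp_restrict_modEq κ L hG hpℓ h (N + 1)
  rw [eK, eL, pow_add, pow_add] at cN1
  -- `p^{e_N(L)} · p^{λ_L} ≡ p^{e_N(K)} · p^{λ_K} ≡ p^{e_N(L)} · p^{λ_K}`
  have c2 : p ^ classNumberPExp (κ.restrict L h) N * p ^ classicalLambda (κ.restrict L h) ≡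
      p ^ classNumberPExp (κ.restrict L h) N * p ^ classicalLambda κ [MOD ℓ] :=
    cN1.trans (Nat.ModEq.mul_right _ cN.symm)
  have hcop : Nat.Coprime (p ^ classNumberPExp (κ.restrict L h) N) ℓ :=
    Nat.Coprime.pow_left _ ((Nat.coprime_primes Fact.out Fact.out).mpr hpℓ)
  exact Nat.ModEq.cancel_left_of_coprime (by rwa [Nat.coprime_comm] at hcop) c2

/-! ### §3 Parity: `p ≡ −1 (mod ℓ)`; the cubic case `ℓ = 3`, `p = 2` -/

/-- **`e_n(κ|_L) ≡ e_n(κ) (mod 2)`** for `Gal(L/K)` an `ℓ`-group, `2 < ℓ`, `p ≡ −1 (mod ℓ)`. [cite: Washington1997, Thm. 10.8 and §13.1] -/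
theorem classNumberPExp_restrict_modEq_two (hG : IsPGroup ℓ (L ≃ₐ[K] L)) (hℓ : 2 < ℓ) (hp : (p : ZMod ℓ) = -1)
    (h : Function.Surjective (κ.toContinuousMonoidHom.comp (absGaloisRestrict K L))) (n : ℕ) :
    classNumberPExp (κ.restrict L h) n ≡ classNumberPExp κ n [MOD 2] := by
  have hpℓ : p ≠ ℓ := by
    rintro rfl
    rw [ZMod.natCast_self, zero_eq_neg] at hp
    exact one_ne_zero hp
  exact modEq_two_of_pow_modEq_of_natCast_eq_neg_one hℓ hp (pow_classNumberPExp_restrict_modEq κ L hG hpℓ h n)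

/-- **`r_n(κ|_L) ≡ r_n(κ) (mod 2)`** for `Gal(L/K)` an `ℓ`-group, `2 < ℓ`, `p ≡ −1 (mod ℓ)`. [cite: Washington1997, Thm. 10.8 and §13.1] -/
theorem classGroupPRank_restrict_modEq_two (hG : IsPGroup ℓ (L ≃ₐ[K] L)) (hℓ : 2 < ℓ) (hp : (p : ZMod ℓ) = -1)
    (h : Function.Surjective (κ.toContinuousMonoidHom.comp (absGaloisRestrict K L))) (n : ℕ) :
    classGroupPRank (κ.restrict L h) n ≡ classGroupPRank κ n [MOD 2] := by
  have hpℓ : p ≠ ℓ := by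
    rintro rfl
    rw [ZMod.natCast_self, zero_eq_neg] at hp
    exact one_ne_zero hp
  exact modEq_two_of_pow_modEq_of_natCast_eq_neg_one hℓ hp (pow_classGroupPRank_restrict_modEq κ L hG hpℓ h n)

/-- **`λ(κ|_L) ≡ λ(κ) (mod 2)`** (granted `μ(κ|_L) = 0`) for `Gal(L/K)` an `ℓ`-group, `2 < ℓ`, `p ≡ −1 (mod ℓ)`.
[cite: Washington1997, Thm. 10.8 and §13.3 Thm. 13.13] -/
theorem classicalLambda_restrict_modEq_two (hG : IsPGroup ℓ (L ≃ₐ[K] L)) (hℓ : 2 < ℓ) (hp : (p : ZMod ℓ) = -1)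
    (h : Function.Surjective (κ.toContinuousMonoidHom.comp (absGaloisRestrict K L))) (hμ : ClassicalMuVanishes (κ.restrict L h)) :
    classicalLambda (κ.restrict L h) ≡ classicalLambda κ [MOD 2] := by
  have hpℓ : p ≠ ℓ := by
    rintro rfl
    rw [ZMod.natCast_self, zero_eq_neg] at hp
    exact one_ne_zero hp
  exact modEq_two_of_pow_modEq_of_natCast_eq_neg_one hℓ hp (pow_classicalLambda_restrict_modEq κ L hG hpℓ h hμ)

end Layers

/-! ### §3b The cubic case at `p = 2` -/

section Cubic

variable (κ : ZpExtension K 2) (L : Type) [Field L] [NumberField L] [Algebra K L] [IsGalois K L]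

/-- `2 ≡ −1 (mod 3)`. [folklore] -/
private theorem two_zmod_three : ((2 : ℕ) : ZMod 3) = -1 := by decide

/-- `[L : K] ∣ 3` ⟹ `κ ∘ res_{L/K}` onto for a `ℤ₂`-extension `κ` (`2 ∤ [L:K]`). [cite: Washington1997, §13.1] -/
theorem surjective_comp_absGaloisRestrict_of_finrank_dvd_three (h3 : Module.finrank K L ∣ 3) :
    Function.Surjective (κ.toContinuousMonoidHom.comp (absGaloisRestrict K L)) := by
  haveI : Fact (Nat.Prime 3) := ⟨Nat.prime_three⟩
  exact surjective_comp_absGaloisRestrict_of_isPGroup κ L (isPGroup_three_of_finrank_dvd_three K L h3) (by norm_num)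

/-- ★ **Cubic parity along a `ℤ₂`-tower: `e_n(κ|_L) ≡ e_n(κ) (mod 2)`** at every layer, for `L/K` Galois of degree dividing `3` and ANY
`ℤ₂`-extension `κ` of `K`. [cite: Washington1997, Thm. 10.8 and §13.1] -/
theorem classNumberPExp_restrict_modEq_two_of_finrank_dvd_three (h3 : Module.finrank K L ∣ 3)
    (h : Function.Surjective (κ.toContinuousMonoidHom.comp (absGaloisRestrict K L))) (n : ℕ) :
    classNumberPExp (κ.restrict L h) n ≡ classNumberPExp κ n [MOD 2] := by
  haveI : Fact (Nat.Prime 3) := ⟨Nat.prime_three⟩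
  exact classNumberPExp_restrict_modEq_two κ L (isPGroup_three_of_finrank_dvd_three K L h3) (by norm_num) two_zmod_three h n

/-- ★ **Cubic parity along a `ℤ₂`-tower: `r_n(κ|_L) ≡ r_n(κ) (mod 2)`** (`2`-ranks of the class groups of the layers), `[L : K] ∣ 3`.
[cite: Washington1997, Thm. 10.8 and §13.1] -/
theorem classGroupPRank_restrict_modEq_two_of_finrank_dvd_three (h3 : Module.finrank K L ∣ 3)
    (h : Function.Surjective (κ.toContinuousMonoidHom.comp (absGaloisRestrict K L))) (n : ℕ) :
    classGroupPRank (κ.restrict L h) n ≡ classGroupPRank κ n [MOD 2] := by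
  haveI : Fact (Nat.Prime 3) := ⟨Nat.prime_three⟩
  exact classGroupPRank_restrict_modEq_two κ L (isPGroup_three_of_finrank_dvd_three K L h3) (by norm_num) two_zmod_three h n

/-- ★ **Cubic parity of `λ₂`: `λ(κ|_L) ≡ λ(κ) (mod 2)`** (granted `μ(κ|_L) = 0`), `[L : K] ∣ 3`; together with `λ(κ) ≤ λ(κ|_L)`
(`classicalLambda_le_restrict_of_isPGroup`). [cite: Washington1997, Thm. 10.8 and §13.3 Thm. 13.13] [cite: Iwasawa1973MuInvariants, §3] -/
theorem classicalLambda_restrict_modEq_two_of_finrank_dvd_three (h3 : Module.finrank K L ∣ 3)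
    (h : Function.Surjective (κ.toContinuousMonoidHom.comp (absGaloisRestrict K L))) (hμ : ClassicalMuVanishes (κ.restrict L h)) :
    classicalLambda (κ.restrict L h) ≡ classicalLambda κ [MOD 2] := by
  haveI : Fact (Nat.Prime 3) := ⟨Nat.prime_three⟩
  exact classicalLambda_restrict_modEq_two κ L (isPGroup_three_of_finrank_dvd_three K L h3) (by norm_num) two_zmod_three h hμ

/-- `λ(κ) ≤ λ(κ|_L)` for `[L : K] ∣ 3`, `p = 2` (granted `μ(κ|_L) = 0`). [cite: Iwasawa1973MuInvariants, §3] -/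
theorem classicalLambda_le_restrict_of_finrank_dvd_three (h3 : Module.finrank K L ∣ 3)
    (h : Function.Surjective (κ.toContinuousMonoidHom.comp (absGaloisRestrict K L))) (hμ : ClassicalMuVanishes (κ.restrict L h)) :
    classicalLambda κ ≤ classicalLambda (κ.restrict L h) := by
  haveI : Fact (Nat.Prime 3) := ⟨Nat.prime_three⟩
  exact classicalLambda_le_restrict_of_isPGroup κ L (isPGroup_three_of_finrank_dvd_three K L h3) (by norm_num) h hμ

end Cubic

/-! ### §4 Cyclotomic consumer forms (any normalisations of the cyclotomic towers of `K` and `L`) -/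

section Cyclotomic

variable (L : Type) [Field L] [NumberField L] [Algebra K L] [IsGalois K L] {ℓ : ℕ} [Fact ℓ.Prime]

/-- Two cyclotomic `ℤ_p`-extensions of one field have the same `λ` (they have the same `e_n`, `classNumberPExp_eq_of_isCyclotomic`, and `λ` is
determined by the sequence `e_n`, `eq_classicalLambda_of_growth`). [cite: Washington1997, §13.1 and §13.3 Thm. 13.13] -/
theorem classicalLambda_eq_of_isCyclotomic {F : Type} [Field F] (κ₁ κ₂ : ZpExtension F p) (h₁ : κ₁.IsCyclotomic) (h₂ : κ₂.IsCyclotomic) :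
    classicalLambda κ₁ = classicalLambda κ₂ := by
  have he : ∀ n, classNumberPExp κ₁ n = classNumberPExp κ₂ n := fun n => classNumberPExp_eq_of_isCyclotomic κ₁ κ₂ h₁ h₂ n
  by_cases hμ : ClassicalMuVanishes κ₁
  · obtain ⟨ν, n₀, hν⟩ := classicalLambda_spec κ₁ hμ
    exact eq_classicalLambda_of_growth κ₂ (ν := ν) (n₀ := n₀) fun n hn => by rw [← he n]; exact hν n hn
  · have hμ' : ¬ ClassicalMuVanishes κ₂ := fun h' => hμ ((classicalMuVanishes_iff_of_isCyclotomic κ₁ κ₂ h₁ h₂).mpr h')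
    rw [classicalLambda_eq_zero_of_not_classicalMuVanishes κ₁ hμ, classicalLambda_eq_zero_of_not_classicalMuVanishes κ₂ hμ']

/-- ★ **`p^{e_n(L)} ≡ p^{e_n(K)} (mod ℓ)` and `e_n(K) ≤ e_n(L)` for the CYCLOTOMIC `ℤ_p`-towers of `K ⊆ L`**, `L/K` Galois with an `ℓ`-group,
`ℓ ≠ p`, whatever the normalisations `κK`, `κL`. [cite: Washington1997, §10.1, Thm. 10.8 and §13.1] -/
theorem pow_classNumberPExp_modEq_of_isCyclotomic (hG : IsPGroup ℓ (L ≃ₐ[K] L)) (hpℓ : p ≠ ℓ) (κK : ZpExtension K p) (hκK : κK.IsCyclotomic)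
    (κL : ZpExtension L p) (hκL : κL.IsCyclotomic) (n : ℕ) :
    p ^ classNumberPExp κL n ≡ p ^ classNumberPExp κK n [MOD ℓ] ∧ classNumberPExp κK n ≤ classNumberPExp κL n := by
  have h := surjective_comp_absGaloisRestrict_of_isPGroup κK L hG hpℓ
  have hc : (κK.restrict L h).IsCyclotomic := isCyclotomic_restrict κK hκK L h
  rw [classNumberPExp_eq_of_isCyclotomic κL (κK.restrict L h) hκL hc n]
  exact ⟨pow_classNumberPExp_restrict_modEq κK L hG hpℓ h n, classNumberPExp_le_restrict_of_isPGroup κK L hG hpℓ h n⟩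

/-- ★ **`p^{r_n(L)} ≡ p^{r_n(K)} (mod ℓ)` and `r_n(K) ≤ r_n(L)` for the cyclotomic `ℤ_p`-towers** (`p`-ranks of class groups), `L/K` Galois with an
`ℓ`-group, `ℓ ≠ p`. [cite: Washington1997, Thm. 10.8 and §13.1] -/
theorem pow_classGroupPRank_modEq_of_isCyclotomic (hG : IsPGroup ℓ (L ≃ₐ[K] L)) (hpℓ : p ≠ ℓ) (κK : ZpExtension K p) (hκK : κK.IsCyclotomic)
    (κL : ZpExtension L p) (hκL : κL.IsCyclotomic) (n : ℕ) :
    p ^ classGroupPRank κL n ≡ p ^ classGroupPRank κK n [MOD ℓ] ∧ classGroupPRank κK n ≤ classGroupPRank κL n := by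
  have h := surjective_comp_absGaloisRestrict_of_isPGroup κK L hG hpℓ
  have hc : (κK.restrict L h).IsCyclotomic := isCyclotomic_restrict κK hκK L h
  rw [CoatesSujatha2005.classGroupPRank_eq_of_isCyclotomic κL (κK.restrict L h) hκL hc n]
  exact ⟨pow_classGroupPRank_restrict_modEq κK L hG hpℓ h n, classGroupPRank_le_restrict_of_isPGroup κK L hG hpℓ h n⟩

/-- ★ **`μ_p(L^{cyc}) = 0 ⟹ μ_p(K^{cyc}) = 0`, `λ_p(K) ≤ λ_p(L)` and `p^{λ_p(L)} ≡ p^{λ_p(K)} (mod ℓ)`** for the cyclotomic `ℤ_p`-towers of `K ⊆ L`,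
`L/K` Galois with an `ℓ`-group, `ℓ ≠ p`. [cite: Washington1997, Thm. 10.8 and §13.3 Thm. 13.13] [cite: Iwasawa1973MuInvariants, §3] -/
theorem pow_classicalLambda_modEq_of_isCyclotomic (hG : IsPGroup ℓ (L ≃ₐ[K] L)) (hpℓ : p ≠ ℓ) (κK : ZpExtension K p) (hκK : κK.IsCyclotomic)
    (κL : ZpExtension L p) (hκL : κL.IsCyclotomic) (hμ : ClassicalMuVanishes κL) :
    ClassicalMuVanishes κK ∧ classicalLambda κK ≤ classicalLambda κL ∧ p ^ classicalLambda κL ≡ p ^ classicalLambda κK [MOD ℓ] := by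
  have h := surjective_comp_absGaloisRestrict_of_isPGroup κK L hG hpℓ
  have hc : (κK.restrict L h).IsCyclotomic := isCyclotomic_restrict κK hκK L h
  have hμ' : ClassicalMuVanishes (κK.restrict L h) := (classicalMuVanishes_iff_of_isCyclotomic κL (κK.restrict L h) hκL hc).mp hμ
  rw [classicalLambda_eq_of_isCyclotomic κL (κK.restrict L h) hκL hc]
  exact ⟨classicalMuVanishes_of_restrict_of_isPGroup κK L hG hpℓ h hμ', classicalLambda_le_restrict_of_isPGroup κK L hG hpℓ h hμ',
    pow_classicalLambda_restrict_modEq κK L hG hpℓ h hμ'⟩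

/-- ★ **THE CUBIC PARITY LAW FOR CYCLOTOMIC `ℤ₂`-TOWERS.** `L/K` Galois of degree dividing `3`, `κK`, `κL` any cyclotomic `ℤ₂`-extensions of `K`, `L`:
for every `n`, `e_n(L) ≡ e_n(K) (mod 2)` and `rank₂ Cl(L_n) ≡ rank₂ Cl(K_n) (mod 2)`, with `e_n(K) ≤ e_n(L)`, `rank₂ Cl(K_n) ≤ rank₂ Cl(L_n)`.
[cite: Washington1997, Thm. 10.8 and §13.1] -/
theorem classNumberPExp_classGroupPRank_modEq_two_of_isCyclotomic_of_finrank_dvd_three (h3 : Module.finrank K L ∣ 3)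
    (κK : ZpExtension K 2) (hκK : κK.IsCyclotomic) (κL : ZpExtension L 2) (hκL : κL.IsCyclotomic) (n : ℕ) :
    (classNumberPExp κL n ≡ classNumberPExp κK n [MOD 2] ∧ classNumberPExp κK n ≤ classNumberPExp κL n) ∧
      (classGroupPRank κL n ≡ classGroupPRank κK n [MOD 2] ∧ classGroupPRank κK n ≤ classGroupPRank κL n) := by
  haveI : Fact (Nat.Prime 3) := ⟨Nat.prime_three⟩
  have hG := isPGroup_three_of_finrank_dvd_three K L h3
  have h23 : (2 : ℕ) ≠ 3 := by norm_num
  obtain ⟨ce, le⟩ := pow_classNumberPExp_modEq_of_isCyclotomic L hG h23 κK hκK κL hκL n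
  obtain ⟨cr, lr⟩ := pow_classGroupPRank_modEq_of_isCyclotomic L hG h23 κK hκK κL hκL n
  exact ⟨⟨modEq_two_of_pow_modEq_of_natCast_eq_neg_one (by norm_num) (by decide) ce, le⟩,
    ⟨modEq_two_of_pow_modEq_of_natCast_eq_neg_one (by norm_num) (by decide) cr, lr⟩⟩

/-- ★ **THE CUBIC PARITY LAW FOR `λ₂`.** `L/K` Galois of degree dividing `3`, `κK`, `κL` any cyclotomic `ℤ₂`-extensions: `μ₂(L) = 0 ⟹ μ₂(K) = 0`,
`λ₂(K) ≤ λ₂(L)` and `λ₂(L) ≡ λ₂(K) (mod 2)`. [cite: Washington1997, Thm. 10.8 and §13.3 Thm. 13.13] [cite: Iwasawa1973MuInvariants, §3] -/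
theorem classicalLambda_modEq_two_of_isCyclotomic_of_finrank_dvd_three (h3 : Module.finrank K L ∣ 3)
    (κK : ZpExtension K 2) (hκK : κK.IsCyclotomic) (κL : ZpExtension L 2) (hκL : κL.IsCyclotomic) (hμ : ClassicalMuVanishes κL) :
    ClassicalMuVanishes κK ∧ classicalLambda κK ≤ classicalLambda κL ∧ classicalLambda κL ≡ classicalLambda κK [MOD 2] := by
  haveI : Fact (Nat.Prime 3) := ⟨Nat.prime_three⟩
  have hG := isPGroup_three_of_finrank_dvd_three K L h3
  obtain ⟨hμK, hle, hc⟩ := pow_classicalLambda_modEq_of_isCyclotomic L hG (by norm_num) κK hκK κL hκL hμ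
  exact ⟨hμK, hle, modEq_two_of_pow_modEq_of_natCast_eq_neg_one (by norm_num) (by decide) hc⟩

end Cyclotomic

end Literature.NumberTheory.IwasawaTheory

end
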